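import Summits.CriticalPhenomena.PercolationContinuityZ3.Theses.PercNearOneGluing
import Literature.Probability.Percolation.PercolationProofs
import Literature.Probability.Percolation.ConditionalPositiveAssociationProofs
import Literature.Probability.Percolation.TwoClusterConditionalAssociationProofs

/-! TTRL-lite variant V1420 of stmt-CriticalPhenomena-4576 -/

namespace Summit.CriticalPhenomena.PercolationContinuityZ3.Theorems

open MeasureTheory Literature.Probability.LatticeModels Literature.Probability.Percolation
open scoped Classical BigOperators

/-- **Cluster-value partition of the live failure** `Φ(A) = μ(o ↔ A, o ↮ b)`:
`μ_w((⋃ a ∈ A, {o ↔ a}) ∩ {o ↔ b}ᶜ) = Σ_{W ∋ o, W ∩ A ≠ ∅, b ∉ W} μ_w(C(o) = W)`, the event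
being the finite disjoint union of the level sets `{C(o) = W}` over the values `W` of the open
cluster of `o` that meet `A` and miss `b`
(TTRL-lite variant V1420 of `stub_goodStep`, stmt-CriticalPhenomena-4576). [folklore] -/
theorem stub_goodStep_var1420 :
    ∀ (n : ℕ) (w : Sym2 (Fin n) → unitInterval) (A : Finset (Fin n)) (o b : Fin n),
      (prodBernoulli w).real ((⋃ a ∈ A, openConn o a) ∩ (openConn o b)ᶜ) =
        ∑ W ∈ (Finset.univ : Finset (Finset (Fin n))).filter
            (fun W => o ∈ W ∧ ¬ Disjoint W A ∧ b ∉ W),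
          (prodBernoulli w).real
            {ω : BondConfig (Fin n) | openCluster ω o = (W : Set (Fin n))} := by
  intro n w A o b
  set Fl := (Finset.univ : Finset (Finset (Fin n))).filter
    (fun W => o ∈ W ∧ ¬ Disjoint W A ∧ b ∉ W) with hFl
  have hmemFl : ∀ W, W ∈ Fl ↔ o ∈ W ∧ ¬ Disjoint W A ∧ b ∉ W := fun W => by simp [hFl]
  -- the event is the disjoint union of the level sets `{C(o) = W}`, `W ∈ Fl`
  have hdec : ((⋃ a ∈ A, openConn o a) ∩ (openConn o b)ᶜ : Set (BondConfig (Fin n))) =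
      ⋃ W ∈ Fl, {ω : BondConfig (Fin n) | openCluster ω o = (W : Set (Fin n))} := by
    ext ω
    simp only [Set.mem_inter_iff, Set.mem_compl_iff, Set.mem_iUnion, Set.mem_setOf_eq]
    constructor
    · rintro ⟨⟨a, haA, hoa⟩, hob⟩
      refine ⟨(Set.toFinite (openCluster ω o)).toFinset, (hmemFl _).2 ⟨?_, ?_, ?_⟩, ?_⟩
      · exact (Set.Finite.mem_toFinset _).2 (mem_openCluster_self ω o)
      · rw [Finset.not_disjoint_iff]
        have hoa' : a ∈ openCluster ω o := hoa
        exact ⟨a, (Set.Finite.mem_toFinset _).2 hoa', haA⟩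
      · intro hb
        have hb' : b ∈ openCluster ω o := (Set.Finite.mem_toFinset _).1 hb
        exact hob hb'
      · exact (Set.Finite.coe_toFinset _).symm
    · rintro ⟨W, hW, hωW⟩
      obtain ⟨-, hWA, hbW⟩ := (hmemFl W).1 hW
      obtain ⟨a, haW, haA⟩ := Finset.not_disjoint_iff.1 hWA
      refine ⟨⟨a, haA, ?_⟩, ?_⟩
      · have haC : a ∈ openCluster ω o := by
          rw [hωW]; exact Finset.mem_coe.2 haW
        exact haC
      · intro hob
        have hob' : b ∈ openCluster ω o := hob
        rw [hωW] at hob'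
        exact hbW (Finset.mem_coe.1 hob')
  have hdisj : (↑Fl : Set (Finset (Fin n))).PairwiseDisjoint
      fun W => {ω : BondConfig (Fin n) | openCluster ω o = (W : Set (Fin n))} := by
    intro W _ W' _ hne
    rw [Function.onFun, Set.disjoint_left]
    intro ω h h'
    exact hne (Finset.coe_injective (h.symm.trans h'))
  rw [hdec, measureReal_biUnion_finset hdisj fun _ _ => MeasurableSet.of_discrete]

end Summit.CriticalPhenomena.PercolationContinuityZ3.Theorems
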